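import Summits.BirchSwinnertonDyer.Rank1Residual.X11b.KummerRelaxationIndexExact
import Literature.NumberTheory.EllipticCurves.ArchimedeanWeilPairingDuality
import Literature.NumberTheory.EllipticCurves.ArchimedeanKummerImageMaximal
import HarnessLib

/-!
# Route `GenusKolyvaginAtTwo`, LINES 18/19 (L_T stmt-BirchSwinnertonDyer-23242, L⁺_T stmt-23379), step (b) input I5 over `ℚ`:
# POITOU–TATE EXACTNESS FOR THE KUMMER STRUCTURE OVER A NUMBER FIELD WITH REAL PLACES (X11b `exists_mem_kummerOutside_localization_eq`
# without «all infinite places complex», for families of local invariant maps injective at the real places)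

Width seat `bsd-line-gk2-p4` g16 (cell `bsd-f1-sign2`), `--supports stmt-BirchSwinnertonDyer-23242` (helper; closes nothing).
THEOREMS ONLY: no definition, no named fact, no `sorry`; standard axioms.  BSD is NOT proved by any of this.

WHY.  The auxiliary-class files (`…RTAuxiliaryClass*`) prove McCallum's Prop. 2.1 for `K` totally complex because X11b's
Poitou–Tate exactness for the Kummer structure of `E[p^k]` (`KummerPT.exists_mem_kummerOutside_localization_eq`) carries the
hypothesis `hK : ∀ w, w.IsComplex` — used only to dispose of the infinite places when transporting a dual Selmer class along the
Weil self-duality `w⁻¹ : E[n]^D ≅ E[n]`.  The 3a⁗ swap oracle is designed OVER `ℚ` (gk2-p2 g15/g16), so the auxiliary class may be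
wanted over `K = ℚ`.  This file removes `hK`: at a REAL place `w` where `inv_w` is injective (THE canonical family:
`archimedeanInvariantMap_injective_of_isReal`), the dual of the local Kummer condition transports into the Kummer condition by the
tree's RIGHT maximal isotropy over any `K`-field (`GaloisImage.forall_mem_kummerLocalConditionAt_weilCupProduct_eq_zero_right_iff`)
and the archimedean count `#H¹(K_w, E[n]) ≤ #𝓛_w²` (`natCard_galoisCohomology_one_torsion_le_sq_infinitePlace`); complex places
are trivial as before.

WHAT (namespace `…Theorems.GenusExact.AuxiliaryClass`; `W` elliptic over ANY number field `K`).
* `map_weilDualInv_mem_kummer_of_mem_dualLocalCondition_inl` — the archimedean dual transport (any infinite place `w` with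
  `inv_w` injective).
* `map_weilDualInv_mem_kummerOutside_of_mem_dualSelmerGroup_real` — X11b's transport lemma without `hK` (hypothesis
  `hreal : ∀ w, w.IsReal → Injective (inv (inl w))`).
* **`exists_mem_kummerOutside_localization_eq_real`** — POITOU–TATE EXACTNESS for the Kummer structure of `E[p^k]` over ANY
  number field, for families with `IsPerfect`, `SelmerComplement`, Tate's count at finite places and `hreal`.

HONEST FRAMING: the statements are X11b's with `hK` replaced by `hreal`; proofs are X11b's (credited) with the one archimedean
step added; closes nothing.  BSD is NOT proved by any of this.

References: [MilneADT2006] Ch. I Thm. 2.13, Cor. 3.4, Rem. 3.7, Thm. 4.10(b), Lemma 6.15; [Howard2004HeegnerKolyvagin] Thm. 2.1.11;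
[PoonenRains2012] Prop. 4.10; [McCallumLMS1991] §2 Prop. 2.1.
-/

set_option autoImplicit false
-- the Theorems namespace of this sub repeats the summit name by design (D-0017 nested layout)
set_option linter.dupNamespace false

noncomputable section

open scoped Classical

open CategoryTheory Field NumberField IsDedekindDomain Function
open Literature.NumberTheory.EllipticCurves
open Literature.NumberTheory.GaloisRepresentations
open Literature.NumberTheory.GaloisRepresentations.DiscreteGaloisModule (SelmerStructure TateDual tateDual
  localTatePairingZMod mu MuCarrier)
open Literature.NumberTheory.GaloisCohomology
open Summit.BirchSwinnertonDyer.Rank1Residual.X11b.KummerPT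
open Summit.BirchSwinnertonDyer.Rank1Residual.X11b.FiniteDuality
open Summit.BirchSwinnertonDyer.Rank1Residual.X11b.Relaxation
open Summit.BirchSwinnertonDyer.Rank1Residual.X11b.LocBridge
open Summit.BirchSwinnertonDyer.Rank1Residual.X11b.Levels
open Summit.BirchSwinnertonDyer.Rank1Residual.X11b.AcSelmer
open scoped ContRepresentation

namespace Summit.BirchSwinnertonDyer.BirchSwinnertonDyer.Theorems.GenusExact.AuxiliaryClass

variable {K : Type} [Field K] [NumberField K] (W : WeierstrassCurve K) [W.IsElliptic]

/-! ## §1 The archimedean dual transport -/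

section LocalDual

variable (n : ℕ) [NeZero n] [Finite (W.geomTorsion (n : ℤ))]
variable (e : W.geomTorsion n → W.geomTorsion n → AlgebraicClosure K)
  (hμ : ∀ S T, e S T ^ n = 1)
  (hadd₁ : ∀ S₁ S₂ T, e (S₁ + S₂) T = e S₁ T * e S₂ T)
  (hadd₂ : ∀ S T₁ T₂, e S (T₁ + T₂) = e S T₁ * e S T₂)
  (hgal : ∀ (σ : absoluteGaloisGroup K) (S T : W.geomTorsion n), σ • e S T = e (σ • S) (σ • T))
  (halt : ∀ T, e T T = 1) (hnondeg : ∀ T, (∀ S, e S T = 1) → T = 0)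
  (inv : LocalInvariants K n)

omit [Finite (W.geomTorsion (n : ℤ))] in
include hnondeg halt in
/-- **Local Tate duality at an infinite place, right adjoint**: for `inv_w` injective the pairing `inv_w(· ∪ₑ ·)` on
`H¹(K_w, E[n])` has bijective right adjoint (right kernel `eq_zero_of_forall_weilCupProduct_eq_zero_right_infinitePlace` +
counting `#Hom(A, ℤ/n) = #A`). [cite: MilneADT2006, Ch. I, Thm. 2.13] -/
theorem invWeilPairing_flip_bijective_inl (w : InfinitePlace K) (hinv : Injective (inv (Sum.inl w))) :
    Bijective (invWeilPairing W n e hμ hadd₁ hadd₂ hgal inv (Sum.inl w)).flip := by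
  have hnZ : (n : ℤ) ≠ 0 := Int.natCast_ne_zero.mpr (NeZero.ne n)
  haveI := finite_absoluteGaloisGroup_completion_infinitePlace w
  haveI : Finite (galoisCohomology ((W.torsionGaloisModule n).toLocal (Sum.inl w)) 1) :=
    W.finite_galoisCohomology_one_torsion_restrictField_of_finite w.Completion hnZ
  have hA := nsmul_galoisCohomology_toLocal_eq_zero W n (Sum.inl w)
  haveI := finite_addMonoidHom_zmod (galoisCohomology ((W.torsionGaloisModule n).toLocal (Sum.inl w)) 1) n
  have hinj : Injective (invWeilPairing W n e hμ hadd₁ hadd₂ hgal inv (Sum.inl w)).flip := by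
    intro y y' h
    rw [← sub_eq_zero]
    refine eq_zero_of_forall_weilCupProduct_eq_zero_right_infinitePlace W n e hμ hadd₁ hadd₂ w hgal halt hnondeg _
      fun x ↦ ?_
    have h1 : invWeilPairing W n e hμ hadd₁ hadd₂ hgal inv (Sum.inl w) x (y - y') = 0 := by
      have h2 : invWeilPairing W n e hμ hadd₁ hadd₂ hgal inv (Sum.inl w) x y =
          invWeilPairing W n e hμ hadd₁ hadd₂ hgal inv (Sum.inl w) x y' := DFunLike.congr_fun h x
      rw [map_sub, h2, sub_self]
    rw [invWeilPairing_apply] at h1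
    exact hinv (h1.trans (map_zero _).symm)
  exact hinj.bijective_of_nat_card_le (Nat.card_addMonoidHom_zmod hA).le

omit [Finite (W.geomTorsion (n : ℤ))] in
include halt hnondeg in
/-- **`𝓛_w` is its own RIGHT annihilator at an infinite place** for `inv_w(· ∪ₑ ·)`, `inv_w` injective: isotropy
(`invWeilPairing_eq_zero_of_mem`) gives `𝓛_w ≤ 𝓛_w^⊥`; the count `#𝓛_w^⊥ · #𝓛_w = #H¹(K_w, E[n]) ≤ #𝓛_w²`
(`natCard_annRight_mul`, `natCard_galoisCohomology_one_torsion_le_sq_infinitePlace`) forces equality.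
[cite: MilneADT2006, Ch. I, Thm. 2.13 and Rem. 3.7] [cite: PoonenRains2012, Prop. 4.10] -/
theorem annRight_invWeilPairing_kummer_eq_inl (w : InfinitePlace K) (hinv : Injective (inv (Sum.inl w))) :
    annRight (invWeilPairing W n e hμ hadd₁ hadd₂ hgal inv (Sum.inl w)) (W.kummerSelmerStructure (n : ℤ) (Sum.inl w)) =
      W.kummerSelmerStructure (n : ℤ) (Sum.inl w) := by
  have hnZ : (n : ℤ) ≠ 0 := Int.natCast_ne_zero.mpr (NeZero.ne n)
  haveI := finite_absoluteGaloisGroup_completion_infinitePlace w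
  haveI : Finite (galoisCohomology ((W.torsionGaloisModule n).toLocal (Sum.inl w)) 1) :=
    W.finite_galoisCohomology_one_torsion_restrictField_of_finite w.Completion hnZ
  have hA := nsmul_galoisCohomology_toLocal_eq_zero W n (Sum.inl w)
  obtain ⟨b, hb⟩ : ∃ b, b = invWeilPairing W n e hμ hadd₁ hadd₂ hgal inv (Sum.inl w) := ⟨_, rfl⟩
  obtain ⟨L, hL⟩ : ∃ L : AddSubgroup _, L = W.kummerSelmerStructure (n : ℤ) (Sum.inl w) := ⟨_, rfl⟩
  rw [← hb, ← hL]
  -- isotropy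
  have hle : L ≤ annRight b L := fun y hy ↦ (mem_annRight_iff b L y).mpr fun x hx ↦ by
    rw [hb]
    rw [hL] at hx hy
    exact invWeilPairing_eq_zero_of_mem W n e hμ hadd₁ hadd₂ hgal halt inv (Sum.inl w) hx hy
  -- counting
  have hmul : Nat.card (annRight b L) * Nat.card L =
      Nat.card (galoisCohomology ((W.torsionGaloisModule n).toLocal (Sum.inl w)) 1) := by
    rw [hb]
    exact natCard_annRight_mul hA _ (invWeilPairing_flip_bijective_inl W n e hμ hadd₁ hadd₂ hgal halt hnondeg inv w hinv) L
  have hsq : Nat.card (galoisCohomology ((W.torsionGaloisModule n).toLocal (Sum.inl w)) 1) ≤ Nat.card L * Nat.card L := by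
    rw [hL]
    exact W.natCard_galoisCohomology_one_torsion_le_sq_infinitePlace w hnZ
  have hLpos : 0 < Nat.card L := Nat.card_pos
  have hcard : Nat.card (annRight b L) ≤ Nat.card L := by
    apply Nat.le_of_mul_le_mul_right _ hLpos
    rw [hmul]
    exact hsq
  exact (AddSubgroup.eq_of_le_of_card_ge hle hcard).symm

include halt hnondeg in
/-- **The dual of the archimedean Kummer condition, transported along `w⁻¹ : E[n]^D ≅ E[n]`, lies in the Kummer condition**:
at an infinite place `w` with `inv_w` injective, `y_w ∈ 𝓛_w^*` (`⟨a, y_w⟩_w = 0` for all `a ∈ 𝓛_w`) ⟹ `H¹(w⁻¹_w) y_w ∈ 𝓛_w`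
— `⟨a, H¹(w_w) ỹ⟩_w = inv_w(a ∪ₑ ỹ)` (`localTatePairingZMod_map_weilDual`) and `𝓛_w^⊥ = 𝓛_w` (`annRight_invWeilPairing_kummer_eq_inl`).
[cite: MilneADT2006, Ch. I, Thm. 2.13 and Rem. 3.7] -/
theorem map_weilDualInv_mem_kummer_of_mem_dualLocalCondition_inl (w : InfinitePlace K)
    (hinv : Injective (inv (Sum.inl w)))
    {yv : galoisCohomology (((W.torsionGaloisModule n).tateDual n).toLocal (Sum.inl w)) 1}
    (hyv : yv ∈ inv.dualLocalCondition (W.torsionGaloisModule n) (Sum.inl w)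
      (W.kummerSelmerStructure (n : ℤ) (Sum.inl w))) :
    galoisCohomology.map ((weilDualInv W n e hμ hadd₁ hadd₂ hgal hnondeg).restrictField
        (Place.Completion (Sum.inl w : Place K))) 1 yv ∈
      W.kummerSelmerStructure (n : ℤ) (Sum.inl w) := by
  obtain ⟨yW, hyWdef⟩ : ∃ yW : galoisCohomology ((W.torsionGaloisModule n).toLocal (Sum.inl w)) 1,
      yW = galoisCohomology.map ((weilDualInv W n e hμ hadd₁ hadd₂ hgal hnondeg).restrictField
        (Place.Completion (Sum.inl w : Place K))) 1 yv := ⟨_, rfl⟩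
  rw [← hyWdef]
  have hw : galoisCohomology.map ((weilDualIntertwining W n e hμ hadd₁ hadd₂ hgal).restrictField
      (Place.Completion (Sum.inl w : Place K))) 1 yW = yv := by
    rw [hyWdef]
    exact map_weilDual_map_weilDualInv_restrictField W n e hμ hadd₁ hadd₂ hgal hnondeg _ yv
  have key : yW ∈ annRight (invWeilPairing W n e hμ hadd₁ hadd₂ hgal inv (Sum.inl w))
      (W.kummerSelmerStructure (n : ℤ) (Sum.inl w)) := by
    rw [mem_annRight_iff]
    intro a ha
    rw [invWeilPairing_apply, ← localTatePairingZMod_map_weilDual W n e hμ hadd₁ hadd₂ hgal (Sum.inl w)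
      (inv (Sum.inl w)) a yW, hw]
    exact (inv.mem_dualLocalCondition_iff (W.torsionGaloisModule n) (Sum.inl w) _ yv).mp hyv a ha
  rwa [annRight_invWeilPairing_kummer_eq_inl W n e hμ hadd₁ hadd₂ hgal halt hnondeg inv w hinv] at key

include halt hnondeg in
/-- **The Weil transport of a dual Selmer class for `(kummerStrict S')^*` lies in `kummerOutside W n S'`** — X11b's
`map_weilDualInv_mem_kummerOutside_of_mem_dualSelmerGroup` WITHOUT «all infinite places complex»: `inv_v` injective and Tate's
count at the finite `v ∉ S'`, and `inv_w` injective at the REAL places (complex places: every local class vanishes; real places: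
`map_weilDualInv_mem_kummer_of_mem_dualLocalCondition_inl`). [cite: MilneADT2006, Ch. I §6, proof of Prop. 6.9]
[cite: JetchevSkinnerWan2017, Prop. 3.3.2 (arXiv:1512.06894 p. 11)] -/
theorem map_weilDualInv_mem_kummerOutside_of_mem_dualSelmerGroup_real (S' : Finset (Place K))
    (hinv : ∀ v : HeightOneSpectrum (𝓞 K), (Sum.inr v : Place K) ∉ S' → Injective (inv (Sum.inr v)))
    (hEuler : ∀ v : HeightOneSpectrum (𝓞 K), (Sum.inr v : Place K) ∉ S' →
      Nat.card (galoisCohomology ((W.torsionGaloisModule n).toLocal (Sum.inr v)) 1) =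
        (Nat.card (nsmulAddMonoidHom n : (W.baseChange (v.adicCompletion K)).toAffine.Point →+ _).ker *
          Nat.card (v.adicCompletionIntegers K ⧸ Ideal.span {(n : v.adicCompletionIntegers K)})) ^ 2)
    (hreal : ∀ w : InfinitePlace K, w.IsReal → Injective (inv (Sum.inl w)))
    {y : galoisCohomology ((W.torsionGaloisModule n).tateDual n) 1}
    (hy : y ∈ (inv.dualSelmerStructure (W.torsionGaloisModule n) (kummerStrict W n S')).selmerGroup) :
    galoisCohomology.map (weilDualInv W n e hμ hadd₁ hadd₂ hgal hnondeg) 1 y ∈ kummerOutside W n S' := by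
  obtain ⟨yW, hyWdef⟩ : ∃ yW, yW = galoisCohomology.map (weilDualInv W n e hμ hadd₁ hadd₂ hgal hnondeg) 1 y :=
    ⟨_, rfl⟩
  rw [← hyWdef, mem_kummerOutside_iff]
  intro v hv
  have hyv := (SelmerStructure.mem_selmerGroup_iff _ y).mp hy v
  rw [LocalInvariants.dualSelmerStructure_apply, kummerStrict_of_not_mem W n S' hv] at hyv
  change galoisCohomology.localization (W.torsionGaloisModule (n : ℤ)) v 1 yW ∈
    W.kummerSelmerStructure (n : ℤ) v
  cases v with
  | inl w =>
    by_cases hw : w.IsComplex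
    · rw [localization_inl_eq_zero_of_isComplex _ hw]
      exact zero_mem _
    · rw [hyWdef, localization_map_one]
      exact map_weilDualInv_mem_kummer_of_mem_dualLocalCondition_inl W n e hμ hadd₁ hadd₂ hgal halt hnondeg inv w
        (hreal w (InfinitePlace.not_isComplex_iff_isReal.mp hw)) hyv
  | inr v =>
    rw [hyWdef, localization_map_one]
    exact map_weilDualInv_mem_kummer_of_mem_dualLocalCondition W n e hμ hadd₁ hadd₂ hgal halt hnondeg
      inv v (hinv v hv) (hEuler v hv) hyv

end LocalDual

/-! ## §2 Poitou–Tate exactness for the Kummer structure over any number field -/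

section Exactness

variable (p k : ℕ) [Fact p.Prime] [Finite (W.geomTorsion ((p ^ k : ℕ) : ℤ))]
variable (e : W.geomTorsion ((p ^ k : ℕ) : ℤ) → W.geomTorsion ((p ^ k : ℕ) : ℤ) → AlgebraicClosure K)
  (hμ : ∀ S T, e S T ^ (p ^ k) = 1)
  (hadd₁ : ∀ S₁ S₂ T, e (S₁ + S₂) T = e S₁ T * e S₂ T)
  (hadd₂ : ∀ S T₁ T₂, e S (T₁ + T₂) = e S T₁ * e S T₂)
  (hgal : ∀ (σ : absoluteGaloisGroup K) (S T : W.geomTorsion ((p ^ k : ℕ) : ℤ)),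
    σ • e S T = e (σ • S) (σ • T))
  (halt : ∀ T, e T T = 1) (hnondeg : ∀ T, (∀ S, e S T = 1) → T = 0)

include halt hnondeg in
/-- **POITOU–TATE EXACTNESS FOR THE KUMMER STRUCTURE OVER ANY NUMBER FIELD** (X11b's `exists_mem_kummerOutside_localization_eq`
with «all infinite places complex» replaced by «`inv_w` injective at the real places»): for a Poitou–Tate family `inv` at level
`p^k` with `IsPerfect`, `SelmerComplement`, Tate's count at every finite place and `hreal`, if `t_v ∈ H¹(K_v, E[p^k])` (`v ∈ S'`)
satisfies `∑_{v∈S'} inv_v(t_v ∪ₑ loc_v c) = 0` for every `c ∈ kummerOutside W (p^k) S'`, then `t_v = loc_v x` on `S'` for some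
`x ∈ kummerOutside W (p^k) S'`.  Proof: X11b's, verbatim, with the transport lemma of §1.
[cite: Howard2004HeegnerKolyvagin, Thm. 2.1.11 (arXiv:1202.6340 p. 6)] [cite: MilneADT2006, Ch. I, Thm. 4.10(b) and Lemma 6.15] -/
theorem exists_mem_kummerOutside_localization_eq_real
    {inv : LocalInvariants K (p ^ k)} (hperf : inv.IsPerfect) (hcompl : inv.SelmerComplement)
    (hEuler : ∀ v : HeightOneSpectrum (𝓞 K),
      Nat.card (galoisCohomology ((W.torsionGaloisModule ((p ^ k : ℕ) : ℤ)).toLocal (Sum.inr v)) 1) =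
        (Nat.card (nsmulAddMonoidHom (p ^ k) :
            (W.baseChange (v.adicCompletion K)).toAffine.Point →+ _).ker *
          Nat.card (v.adicCompletionIntegers K ⧸
            Ideal.span {((p ^ k : ℕ) : v.adicCompletionIntegers K)})) ^ 2)
    (hreal : ∀ w : InfinitePlace K, w.IsReal → Injective (inv (Sum.inl w)))
    (S' : Finset (Place K))
    (t : Π v : Place K, galoisCohomology ((W.torsionGaloisModule ((p ^ k : ℕ) : ℤ)).toLocal v) 1)
    (ht : ∀ c ∈ kummerOutside W (p ^ k) S',
      ∑ v ∈ S', invWeilPairing W (p ^ k) e hμ hadd₁ hadd₂ hgal inv v (t v)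
        (galoisCohomology.localization (W.torsionGaloisModule ((p ^ k : ℕ) : ℤ)) v 1 c) = 0) :
    ∃ x ∈ kummerOutside W (p ^ k) S', ∀ v ∈ S',
      galoisCohomology.localization (W.torsionGaloisModule ((p ^ k : ℕ) : ℤ)) v 1 x = t v := by
  classical
  obtain ⟨T, hS'T, hinf, hp, hbad⟩ := exists_exceptional_finset W p S'
  have hMn : ∀ m : W.geomTorsion ((p ^ k : ℕ) : ℤ), (p ^ k) • m = 0 := fun m ↦
    AddSubgroup.torsionBy.nsmul m
  have hTout : ∀ v : HeightOneSpectrum (𝓞 K), (Sum.inr v : Place K) ∉ T →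
      ((p ^ k : ℕ) : 𝓞 K) ∉ v.asIdeal ∧
        GaloisRep.IsUnramifiedAt v (W.torsionGaloisModule ((p ^ k : ℕ) : ℤ)) := by
    intro v hv
    have hpv : ((p : ℕ) : 𝓞 K) ∉ v.asIdeal := fun h ↦ hv (hp v h)
    have hgood : W.HasGoodReductionAt v := by
      by_contra hbad'
      exact hv (hbad v hbad')
    exact ⟨natCast_pow_not_mem p hpv _,
      isUnramifiedAt_torsionGaloisModule W hgood (intCast_pow_not_mem p hpv _)⟩
  -- the test family, extended by zero off `S'`
  obtain ⟨t', ht'mem, ht'not⟩ : ∃ t' : Π v : Place K,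
      galoisCohomology ((W.torsionGaloisModule ((p ^ k : ℕ) : ℤ)).toLocal v) 1,
      (∀ v ∈ S', t' v = t v) ∧ (∀ v ∉ S', t' v = 0) :=
    ⟨fun v ↦ if v ∈ S' then t v else 0, fun v hv ↦ if_pos hv, fun v hv ↦ if_neg hv⟩
  have ht' : ∀ v ∈ T, t' v ∈ kummerRelaxed W (p ^ k) S' v := by
    intro v _
    by_cases hv : v ∈ S'
    · rw [kummerRelaxed_of_mem W (p ^ k) S' hv]; exact AddSubgroup.mem_top _
    · rw [ht'not v hv]; exact zero_mem _
  -- Poitou–Tate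
  obtain ⟨x, hx, hxt⟩ := (hcompl (W.torsionGaloisModule ((p ^ k : ℕ) : ℤ)) hMn T hTout
    (kummerStrict W (p ^ k) S') (kummerRelaxed W (p ^ k) S') (kummerStrict_le_kummerRelaxed W (p ^ k) S')
    (kummerStrict_isUnramifiedOutside W p k S' T hS'T hinf hp hbad)
    (kummerRelaxed_isUnramifiedOutside W p k S' T hS'T hinf hp hbad)).1 t' ht' (fun y hy ↦ by
      -- the obstruction vanishes
      obtain ⟨yW, hyWdef⟩ : ∃ yW, yW = galoisCohomology.map
          (weilDualInv W (p ^ k) e hμ hadd₁ hadd₂ hgal hnondeg) 1 y := ⟨_, rfl⟩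
      have hyW : galoisCohomology.map (weilDualIntertwining W (p ^ k) e hμ hadd₁ hadd₂ hgal) 1 yW = y := by
        rw [hyWdef]; exact map_weilDual_map_weilDualInv W (p ^ k) e hμ hadd₁ hadd₂ hgal hnondeg y
      have hyKO : yW ∈ kummerOutside W (p ^ k) S' := by
        rw [hyWdef]
        exact map_weilDualInv_mem_kummerOutside_of_mem_dualSelmerGroup_real W (p ^ k) e hμ hadd₁ hadd₂ hgal halt
          hnondeg inv S' (fun v _ ↦ (hperf v).1.1) (fun v _ ↦ hEuler v) hreal hy
      have hterm : ∀ v : Place K,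
          localTatePairingZMod (W.torsionGaloisModule ((p ^ k : ℕ) : ℤ)) (p ^ k) v (inv v) (t' v)
            (galoisCohomology.localization
              ((W.torsionGaloisModule ((p ^ k : ℕ) : ℤ)).tateDual (p ^ k)) v 1 y) =
          invWeilPairing W (p ^ k) e hμ hadd₁ hadd₂ hgal inv v (t' v)
            (galoisCohomology.localization (W.torsionGaloisModule ((p ^ k : ℕ) : ℤ)) v 1 yW) := by
        intro v
        rw [← hyW, localization_map_one, localTatePairingZMod_map_weilDual, invWeilPairing_apply]
      calc ∑ v ∈ T, localTatePairingZMod (W.torsionGaloisModule ((p ^ k : ℕ) : ℤ)) (p ^ k) v (inv v)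
              (t' v) (galoisCohomology.localization
                ((W.torsionGaloisModule ((p ^ k : ℕ) : ℤ)).tateDual (p ^ k)) v 1 y)
          = ∑ v ∈ T, invWeilPairing W (p ^ k) e hμ hadd₁ hadd₂ hgal inv v (t' v)
              (galoisCohomology.localization (W.torsionGaloisModule ((p ^ k : ℕ) : ℤ)) v 1 yW) :=
            Finset.sum_congr rfl fun v _ ↦ hterm v
        _ = ∑ v ∈ S', invWeilPairing W (p ^ k) e hμ hadd₁ hadd₂ hgal inv v (t' v)
              (galoisCohomology.localization (W.torsionGaloisModule ((p ^ k : ℕ) : ℤ)) v 1 yW) := by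
            refine (Finset.sum_subset hS'T fun v _ hvS' ↦ ?_).symm
            rw [ht'not v hvS', map_zero, AddMonoidHom.zero_apply]
        _ = ∑ v ∈ S', invWeilPairing W (p ^ k) e hμ hadd₁ hadd₂ hgal inv v (t v)
              (galoisCohomology.localization (W.torsionGaloisModule ((p ^ k : ℕ) : ℤ)) v 1 yW) :=
            Finset.sum_congr rfl fun v hv ↦ by rw [ht'mem v hv]
        _ = 0 := ht yW hyKO)
  refine ⟨x, ?_, fun v hv ↦ ?_⟩
  · rw [← selmerGroup_kummerRelaxed W (p ^ k) S']
    exact hx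
  · have h := hxt v (hS'T hv)
    rw [kummerStrict_of_mem W (p ^ k) S' hv, AddSubgroup.mem_bot, sub_eq_zero, ht'mem v hv] at h
    exact h

end Exactness

end Summit.BirchSwinnertonDyer.BirchSwinnertonDyer.Theorems.GenusExact.AuxiliaryClass

end
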